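import Literature.RepresentationTheory.KonnoKonno2007.JunctionContinuityKAK
import Literature.RepresentationTheory.KonnoKonno2007.JunctionHyperbolicFamily
import Literature.RepresentationTheory.KonnoKonno2007.RealUnitaryRankOneKAK
import HarnessLib

/-!
# (w1) for the rank-one real unitary junction `U(P,Q) × U(R,S)`, `|Q| = 1`, `U(R,S)` compact — the instantiated theorem (Folland 1989 §4.2; Knapp 2002 Thm 7.39; Konno–Konno 2007 §3, Lemma 5.2)

Topic `RepresentationTheory/KonnoKonno2007`; namespace `Literature.RepresentationTheory.KonnoKonno2007.RealDualPair`.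
This file only PLUGS the three kernel leaves together:

* `JunctionContinuityKAK.isArchWeilDatum_junction` — (w1) from (w2)+(w2′) + continuous vacuum orbit on `K_V × K_W`,
  given a boost `a` of `U(P,Q)` with a jointly continuous covariant implementer family, a Weyl element, a proper
  surjective `KAK` map, and `kV R S` onto;
* `JunctionHyperbolicFamily` — the boost's implementer family on `𝓢`: `hypOp R S p₀ q₀ t`, `hypOp_add_apply`,
  `continuous_hypOp_uncurry`, `isPhaseCovariantS_hypOp`, `exists_liftsTo_hypOp` (for `hyp R S p₀ q₀ t = (hypV p₀ q₀ t, 1)`);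
* `RealUnitaryRankOneKAK` — the group side for `|Q| = 1`: `hypV p₀ q₀`, `hypV_add`, the Weyl element `weylKV p₀` with
  `kV_weylKV_mul_hypV_mul_inv`, `isProperMap_kakMap`, `kakMap_surjective`.

Results: **`isArchWeilDatum_junction_rankOne`** (`[Subsingleton Q]`, `hW : kV R S` onto),
**`isArchWeilDatum_junction_rankOne_of_vacScalar`** (vacuum hypothesis in the printed form
`ω(κ k) h₀ = vacScalar e k • h₀`), the definite-`W` specialisations `…_of_isEmpty_right/left`, and the repackaging
**`fockVacuumCharacter_junction_of_covariant`**: for the tree's junction record, `FockVacuumCharacter (junction P Q R S) e`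
follows from the purely ALGEBRAIC clauses (Heisenberg covariance over `ι𝕎`, unitary lifts, vacuum values) — the
strong-continuity clause (w1) of `IsArchWeilDatum` is no longer an input.  The adjudicated currency
`(P, Q, R, S) = (Fin 2, Unit, Unit, Empty)` (`U(2,1) × U(1)`) is the instance `isArchWeilDatum_ι₁_of_vacScalar`.

Everything is PROVED; no cited fact is a hypothesis.

## References

* [Folland1989] G. B. Folland, *Harmonic Analysis in Phase Space*, Princeton UP 1989: §4.2 (4.23)–(4.24), the Schur
  remark p. 156, Prop. (4.39) (doi:10.1515/9781400882427).
* [Knapp2002] A. W. Knapp, *Lie Groups Beyond an Introduction*, 2nd ed., Birkhäuser 2002: Theorem 7.39, p. 457.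
* [KonnoKonno2007] K. Konno, T. Konno, Kyushu J. Math. 61 (2007) 35–82: §3.1 (3.1), §3.3, Lemma 5.2
  (doi:10.2206/kyushujm.61.35).
-/

noncomputable section

open MeasureTheory Complex SchwartzMap Matrix
open scoped InnerProductSpace ComplexConjugate Real

namespace Literature.RepresentationTheory.KonnoKonno2007

namespace RealDualPair

open Literature.Analysis.SegalBargmann Literature.RepresentationTheory.HeisenbergGroup
open Literature.NumberTheory.Weil1964 Literature.NumberTheory.Automorphic
open Literature.NumberTheory.Automorphic.UnitaryGroup

local notation "SR" σ => SchwartzMap (σ → ℝ) ℂ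
local notation "PV" σ => (σ → ℝ) × (σ → ℝ)

/-- Notation (NOT a definition): `HasUnitaryLift[σ] A` abbreviates the (w2′) clause shape of
`IsArchWeilDatum.exists_lift`. -/
local notation "HasUnitaryLift[" σ "]" A:max =>
  ∃ U : Lp ℂ 2 (volume : Measure (σ → ℝ)) ≃ₗᵢ[ℂ] Lp ℂ 2 (volume : Measure (σ → ℝ)),
    LiftsTo A ((LinearIsometryEquiv.toContinuousLinearEquiv U :
        Lp ℂ 2 (volume : Measure (σ → ℝ)) ≃L[ℂ] Lp ℂ 2 (volume : Measure (σ → ℝ))) :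
      Lp ℂ 2 (volume : Measure (σ → ℝ)) →L[ℂ] Lp ℂ 2 (volume : Measure (σ → ℝ)))

section RankOne

variable {P Q R S : Type*} [Fintype P] [DecidableEq P] [Fintype Q] [DecidableEq Q] [Fintype R] [DecidableEq R]
  [Fintype S] [DecidableEq S]

/-- The covariance of `hypOp` restated over `ι𝕎 P Q R S (hypV p₀ q₀ t, 1)` (definitionally theta-side `hyp R S p₀ q₀ t`).
[cite: KonnoKonno2007, §3.1] -/
theorem isPhaseCovariantS_hypOp_hypV (p₀ : P) (q₀ : Q) :
    IsPhaseCovariantS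
      (fun t : ℝ => ⇑((ι𝕎 P Q R S (hypV p₀ q₀ t, 1)).1 : (PV (DPIdx P Q R S)) ≃ₗ[ℝ] PV (DPIdx P Q R S)))
      (fun t : ℝ => (hypOp R S p₀ q₀ t : (SR (DPIdx P Q R S)) →ₗ[ℂ] SR (DPIdx P Q R S))) :=
  isPhaseCovariantS_hypOp R S p₀ q₀

/-- **(w1) for the rank-one junction** (`|Q| = 1`, `kV R S` onto): Heisenberg covariance over `ι𝕎`, unitary lifts and a
continuous vacuum orbit on `K_V × K_W` give the archimedean Weil datum — strong continuity is DERIVED via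
`hypOp` + Weyl element + `KAK`. [cite: Folland1989, §4.2, the Schur remark p. 156; Prop. (4.39)] -/
theorem isArchWeilDatum_junction_rankOne [Subsingleton Q] (p₀ : P) (q₀ : Q)
    (ω : Representation ℂ (Ginf P Q R S) (SR (DPIdx P Q R S)))
    (hcov : IsPhaseCovariantS
      (fun g => ⇑((ι𝕎 P Q R S g).1 : (PV (DPIdx P Q R S)) ≃ₗ[ℝ] PV (DPIdx P Q R S))) (fun g => ω g))
    (hlift : ∀ g, HasUnitaryLift[DPIdx P Q R S] (ω g))
    (hvac : Continuous fun k : DPK P Q R S => ω (κ P Q R S k) (hermitePi 0))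
    (hW : Function.Surjective (UForm.kV R S)) :
    IsArchWeilDatum (ι𝕎 P Q R S) ω :=
  isArchWeilDatum_junction ω hcov hlift hvac (hypV p₀ q₀) (hypV_add p₀ q₀) (WA := hypOp R S p₀ q₀)
    (isPhaseCovariantS_hypOp_hypV p₀ q₀) (exists_liftsTo_hypOp R S p₀ q₀) (continuous_hypOp_uncurry R S p₀ q₀)
    (hypOp_add_apply R S p₀ q₀) (weylKV p₀) (kV_weylKV_mul_hypV_mul_inv p₀ q₀) (isProperMap_kakMap p₀ q₀)
    (kakMap_surjective p₀ q₀) hW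

/-- **The same with the vacuum hypothesis in the printed form** `ω(κ k) h₀ = vacScalar e k • h₀`.
[cite: KonnoKonno2007, Lemma 5.2; Folland1989, §4.2, the Schur remark p. 156] -/
theorem isArchWeilDatum_junction_rankOne_of_vacScalar [Subsingleton Q] (p₀ : P) (q₀ : Q)
    (ω : Representation ℂ (Ginf P Q R S) (SR (DPIdx P Q R S)))
    (hcov : IsPhaseCovariantS
      (fun g => ⇑((ι𝕎 P Q R S g).1 : (PV (DPIdx P Q R S)) ≃ₗ[ℝ] PV (DPIdx P Q R S))) (fun g => ω g))
    (hlift : ∀ g, HasUnitaryLift[DPIdx P Q R S] (ω g))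
    {e : VacExponents} (hvac : ∀ k : DPK P Q R S, ω (κ P Q R S k) (hermitePi 0) = vacScalar e k • hermitePi 0)
    (hW : Function.Surjective (UForm.kV R S)) :
    IsArchWeilDatum (ι𝕎 P Q R S) ω := by
  refine isArchWeilDatum_junction_rankOne p₀ q₀ ω hcov hlift ?_ hW
  simp_rw [hvac]
  exact (continuous_vacScalar e).smul continuous_const

/-- **Definite `W` on the right** (`S` empty: `U(R,S) = U(R)` compact). [cite: Folland1989, §4.2 p. 156] -/
theorem isArchWeilDatum_junction_rankOne_of_isEmpty_right [Subsingleton Q] [IsEmpty S] (p₀ : P) (q₀ : Q)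
    (ω : Representation ℂ (Ginf P Q R S) (SR (DPIdx P Q R S)))
    (hcov : IsPhaseCovariantS
      (fun g => ⇑((ι𝕎 P Q R S g).1 : (PV (DPIdx P Q R S)) ≃ₗ[ℝ] PV (DPIdx P Q R S))) (fun g => ω g))
    (hlift : ∀ g, HasUnitaryLift[DPIdx P Q R S] (ω g))
    {e : VacExponents} (hvac : ∀ k : DPK P Q R S, ω (κ P Q R S k) (hermitePi 0) = vacScalar e k • hermitePi 0) :
    IsArchWeilDatum (ι𝕎 P Q R S) ω :=
  isArchWeilDatum_junction_rankOne_of_vacScalar p₀ q₀ ω hcov hlift hvac UForm.kV_surjective_of_isEmpty_right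

/-- **Definite `W` on the left** (`R` empty). [cite: Folland1989, §4.2 p. 156] -/
theorem isArchWeilDatum_junction_rankOne_of_isEmpty_left [Subsingleton Q] [IsEmpty R] (p₀ : P) (q₀ : Q)
    (ω : Representation ℂ (Ginf P Q R S) (SR (DPIdx P Q R S)))
    (hcov : IsPhaseCovariantS
      (fun g => ⇑((ι𝕎 P Q R S g).1 : (PV (DPIdx P Q R S)) ≃ₗ[ℝ] PV (DPIdx P Q R S))) (fun g => ω g))
    (hlift : ∀ g, HasUnitaryLift[DPIdx P Q R S] (ω g))
    {e : VacExponents} (hvac : ∀ k : DPK P Q R S, ω (κ P Q R S k) (hermitePi 0) = vacScalar e k • hermitePi 0) :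
    IsArchWeilDatum (ι𝕎 P Q R S) ω :=
  isArchWeilDatum_junction_rankOne_of_vacScalar p₀ q₀ ω hcov hlift hvac UForm.kV_surjective_of_isEmpty_left

/-- **Repackaging for the junction record**: `FockVacuumCharacter (junction P Q R S) e` — whose `IsArchWeilDatum` clause
contains (w1) — follows from the ALGEBRAIC data alone: a representation of `G_∞` on `𝓢` that is Heisenberg-covariant
over `ι𝕎`, has unitary lifts, and takes the printed vacuum values on `K_V × K_W`.
[cite: KonnoKonno2007, Lemma 5.2; Folland1989, §4.2 p. 156, Prop. (4.39)] -/
theorem fockVacuumCharacter_junction_of_covariant [Subsingleton Q] (p₀ : P) (q₀ : Q) (e : VacExponents)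
    (hW : Function.Surjective (UForm.kV R S))
    (h : ∃ ω : Representation ℂ (Ginf P Q R S) (SR (DPIdx P Q R S)),
      IsPhaseCovariantS
          (fun g => ⇑((ι𝕎 P Q R S g).1 : (PV (DPIdx P Q R S)) ≃ₗ[ℝ] PV (DPIdx P Q R S))) (fun g => ω g) ∧
        (∀ g, HasUnitaryLift[DPIdx P Q R S] (ω g)) ∧
        ∀ k : DPK P Q R S, ω (κ P Q R S k) (hermitePi 0) = vacScalar e k • hermitePi 0) :
    (junction P Q R S).FockVacuumCharacter e := by
  obtain ⟨ω, hcov, hlift, hvac⟩ := h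
  exact ⟨ω, isArchWeilDatum_junction_rankOne_of_vacScalar p₀ q₀ ω hcov hlift hvac hW, hvac⟩

end RankOne

/-! ## The adjudicated currency `(Fin 2, Unit, Unit, Empty)`: `U(2,1) × U(1)` -/

section IotaOne

/-- **(w1) at `ι₁`**: for `G_∞ = U(2,1) × U(1)` in the tree's index currency `DPIdx (Fin 2) Unit Unit Empty`, a
Heisenberg-covariant representation on `𝓢(ℝ³)` with unitary lifts and the printed vacuum character IS an archimedean
Weil datum. [cite: KonnoKonno2007, §3.3, Lemma 5.2; Folland1989, §4.2 p. 156] -/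
theorem isArchWeilDatum_ι₁_of_vacScalar
    (ω : Representation ℂ (Ginf (Fin 2) Unit Unit Empty) (SR (DPIdx (Fin 2) Unit Unit Empty)))
    (hcov : IsPhaseCovariantS
      (fun g => ⇑((ι𝕎 (Fin 2) Unit Unit Empty g).1 :
        (PV (DPIdx (Fin 2) Unit Unit Empty)) ≃ₗ[ℝ] PV (DPIdx (Fin 2) Unit Unit Empty))) (fun g => ω g))
    (hlift : ∀ g, HasUnitaryLift[DPIdx (Fin 2) Unit Unit Empty] (ω g))
    {e : VacExponents}
    (hvac : ∀ k : DPK (Fin 2) Unit Unit Empty,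
      ω (κ (Fin 2) Unit Unit Empty k) (hermitePi 0) = vacScalar e k • hermitePi 0) :
    IsArchWeilDatum (ι𝕎 (Fin 2) Unit Unit Empty) ω :=
  isArchWeilDatum_junction_rankOne_of_isEmpty_right (0 : Fin 2) () ω hcov hlift hvac

/-- **The junction record at `ι₁` from algebraic data.** [cite: KonnoKonno2007, Lemma 5.2] -/
theorem fockVacuumCharacter_ι₁_of_covariant (e : VacExponents)
    (h : ∃ ω : Representation ℂ (Ginf (Fin 2) Unit Unit Empty) (SR (DPIdx (Fin 2) Unit Unit Empty)),
      IsPhaseCovariantS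
          (fun g => ⇑((ι𝕎 (Fin 2) Unit Unit Empty g).1 :
            (PV (DPIdx (Fin 2) Unit Unit Empty)) ≃ₗ[ℝ] PV (DPIdx (Fin 2) Unit Unit Empty))) (fun g => ω g) ∧
        (∀ g, HasUnitaryLift[DPIdx (Fin 2) Unit Unit Empty] (ω g)) ∧
        ∀ k : DPK (Fin 2) Unit Unit Empty,
          ω (κ (Fin 2) Unit Unit Empty k) (hermitePi 0) = vacScalar e k • hermitePi 0) :
    (junction (Fin 2) Unit Unit Empty).FockVacuumCharacter e :=
  fockVacuumCharacter_junction_of_covariant (0 : Fin 2) () e UForm.kV_surjective_of_isEmpty_right h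

end IotaOne

end RealDualPair

end Literature.RepresentationTheory.KonnoKonno2007
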